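import Mathlib
import Summits.MatrixMultiplication.MatrixMultiplication.Theses.HiddenToeplitzCorners

/-!
# Kronecker pencils are ω-neutral in every basis — core (crux `HiddenCorners`, stmt-MatrixMultiplication-7492)

Negative-side support for the crux `HiddenCorners` of route `HiddenToeplitzCorners` (line `birth`, stub
`stub_adjugate_family`): the flagship family of the idea card `entangled-adjugate-corners`, the Kronecker /
compression pencils `X ↦ P (X ⊗ 1ₙ) Q` (`N = r·n`, all bases `P, Q`), admits NO split displacement structure
`T_ab − Sᵀ T_ab S = G₀ H₁(ab)ᵀ + G₁(ab) H₀ᵀ` of width `d ≤ r − 2`, for ANY operator `S` all of whose eigenspaces are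
at most one-dimensional (the crux's case `S = Zᵀ`, the transposed lower shift, is the corollary file
`KroneckerNeutral.lean`).  Paper proof and context: `Cruxes/HiddenCorners/KroneckerNeutral.md`, Theorem 1.

Proof architecture (all elementary linear algebra over `ℂ`):
* `core` — the abstract heart: endomorphisms `A₁` (kernel of dimension `≤ 1`) and `A₂` (all eigenspaces of
  dimension `≤ 1`), subspaces `U, V` of codimension `≤ d`, and the RECTANGLE IDENTITY
  `u_mat v_matᵀ = (A₁ u)_mat (A₂ v)_matᵀ` on `U × V` force `r ≤ d + 1`: a transport map `B` on `ℂⁿ` with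
  `A₂ (x ⊗ y) = x ⊗ B y` is built by uniqueness, and an eigenvector of `B` produces a `≥ 2`-dimensional eigenspace
  of `A₂`.
* `kroneckerPencil_le_width_succ` — the matrix statement: from the split identity, `Φ = ker G₀ᵀ`, `Σ = ker H₀ᵀ`
  give the rectangle identity with `u = Pᵀ φ`, `v = Q s`, `A₁ = Pᵀ S P⁻ᵀ`, `A₂ = Q S Q⁻¹`.
No definitions are introduced: pure tensors `x ⊗ y` and row contractions `w ↦ w_mat z` are written as explicit
`LinearMap.pi` terms.
-/

set_option linter.dupNamespace false

namespace Summit.MatrixMultiplication.MatrixMultiplication.Theorems.KroneckerNeutral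

open scoped BigOperators Matrix Kronecker

variable {r n : ℕ}

/-- Pure tensor map `x ↦ x ⊗ y` (value `x a * y i` at `(a, i)`), as an explicit `LinearMap.pi`; apply lemma. -/
theorem tensRight_apply (y : Fin n → ℂ) (x : Fin r → ℂ) (p : Fin r × Fin n) :
    (LinearMap.pi fun q : Fin r × Fin n => y q.2 • (LinearMap.proj q.1 : (Fin r → ℂ) →ₗ[ℂ] ℂ)) x p
      = x p.1 * y p.2 := by
  simp [mul_comm]

/-- `x ↦ x ⊗ y` is injective for `y ≠ 0`. -/
theorem tensRight_injective {y : Fin n → ℂ} (hy : y ≠ 0) :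
    Function.Injective
      (LinearMap.pi fun q : Fin r × Fin n => y q.2 • (LinearMap.proj q.1 : (Fin r → ℂ) →ₗ[ℂ] ℂ)) := by
  obtain ⟨i, hi⟩ : ∃ i, y i ≠ 0 := by
    by_contra h; push Not at h; exact hy (funext h)
  intro x x' h
  ext a
  have := congrFun h (a, i)
  simp only [tensRight_apply] at this
  exact mul_right_cancel₀ hi this

/-- Row contraction `w ↦ (a ↦ Σ_i w(a,i) z_i)` (= `w_mat z`), as an explicit `LinearMap.pi`; apply lemma. -/
theorem rowContr_apply (z : Fin n → ℂ) (w : Fin r × Fin n → ℂ) (a : Fin r) :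
    (LinearMap.pi fun a : Fin r =>
        ∑ i : Fin n, z i • (LinearMap.proj (a, i) : (Fin r × Fin n → ℂ) →ₗ[ℂ] ℂ)) w a
      = ∑ i, w (a, i) * z i := by
  simp [mul_comm]

/-- The row contraction is surjective for `z ≠ 0`. -/
theorem rowContr_surjective {z : Fin n → ℂ} (hz : z ≠ 0) :
    Function.Surjective (LinearMap.pi fun a : Fin r =>
        ∑ i : Fin n, z i • (LinearMap.proj (a, i) : (Fin r × Fin n → ℂ) →ₗ[ℂ] ℂ)) := by
  obtain ⟨i, hi⟩ : ∃ i, z i ≠ 0 := by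
    by_contra h; push Not at h; exact hz (funext h)
  intro t
  refine ⟨fun p => if p.2 = i then t p.1 * (z i)⁻¹ else 0, ?_⟩
  ext a
  rw [rowContr_apply]
  rw [Finset.sum_eq_single i]
  · simp [hi]
  · intro j _ hj; simp [hj]
  · simp

/-- `finrank (ker (w ↦ w_mat z)) + r = r * n` for `z ≠ 0`. -/
theorem finrank_ker_rowContr {z : Fin n → ℂ} (hz : z ≠ 0) :
    Module.finrank ℂ (LinearMap.ker (LinearMap.pi fun a : Fin r =>
        ∑ i : Fin n, z i • (LinearMap.proj (a, i) : (Fin r × Fin n → ℂ) →ₗ[ℂ] ℂ))) + r = r * n := by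
  have h := LinearMap.finrank_range_add_finrank_ker (LinearMap.pi fun a : Fin r =>
        ∑ i : Fin n, z i • (LinearMap.proj (a, i) : (Fin r × Fin n → ℂ) →ₗ[ℂ] ℂ))
  rw [LinearMap.range_eq_top.mpr (rowContr_surjective hz), finrank_top,
    Module.finrank_fintype_fun_eq_card, Fintype.card_fin] at h
  rw [Module.finrank_fintype_fun_eq_card, Fintype.card_prod, Fintype.card_fin, Fintype.card_fin] at h
  omega

/-- Image of a submodule loses at most `finrank (ker f)` dimensions. -/
theorem finrank_le_finrank_map_add {M M' : Type*} [AddCommGroup M] [Module ℂ M] [AddCommGroup M']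
    [Module ℂ M'] [FiniteDimensional ℂ M] (f : M →ₗ[ℂ] M') (p : Submodule ℂ M) :
    Module.finrank ℂ p ≤ Module.finrank ℂ (p.map f) + Module.finrank ℂ (LinearMap.ker f) := by
  have h := LinearMap.finrank_range_add_finrank_ker (f.domRestrict p)
  rw [LinearMap.range_domRestrict] at h
  have hk : Module.finrank ℂ (LinearMap.ker (f.domRestrict p)) ≤ Module.finrank ℂ (LinearMap.ker f) := by
    rw [← Submodule.finrank_map_subtype_eq p (LinearMap.ker (f.domRestrict p))]
    apply Submodule.finrank_mono
    rintro x ⟨y, hy, rfl⟩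
    simpa [LinearMap.mem_ker] using hy
  omega

/-- Preimage of a large subspace under an injective map is large. -/
theorem finrank_comap_ge {M M' : Type*} [AddCommGroup M] [Module ℂ M] [AddCommGroup M']
    [Module ℂ M'] [FiniteDimensional ℂ M] [FiniteDimensional ℂ M'] (f : M →ₗ[ℂ] M')
    (hf : Function.Injective f) (V : Submodule ℂ M') :
    Module.finrank ℂ M + Module.finrank ℂ V ≤
      Module.finrank ℂ (V.comap f) + Module.finrank ℂ M' := by
  have h1 : Module.finrank ℂ ↥(LinearMap.range f ⊓ V) ≤ Module.finrank ℂ (V.comap f) := by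
    rw [← Submodule.map_comap_eq]
    exact Submodule.finrank_map_le _ _
  have h2 := Submodule.finrank_sup_add_finrank_inf_eq (LinearMap.range f) V
  have h3 : Module.finrank ℂ ↥(LinearMap.range f ⊔ V) ≤ Module.finrank ℂ M' :=
    Submodule.finrank_le _
  have h4 := LinearMap.finrank_range_of_inj hf
  omega

/-- **Abstract core of Theorem 1.**  `A₁` with kernel of dimension `≤ 1`, `A₂` with all eigenspaces of
dimension `≤ 1`, subspaces `U, V` of codimension `≤ d`, and the rectangle identity
`u_mat v_matᵀ = (A₁u)_mat (A₂v)_matᵀ` on `U × V` force `r ≤ d + 1`. -/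
theorem core (d : ℕ) (hn : 1 ≤ n)
    (A₁ A₂ : (Fin r × Fin n → ℂ) →ₗ[ℂ] (Fin r × Fin n → ℂ))
    (hA₁ : Module.finrank ℂ (LinearMap.ker A₁) ≤ 1)
    (hA₂ : ∀ (μ : ℂ) (W : Submodule ℂ (Fin r × Fin n → ℂ)),
      (∀ w ∈ W, A₂ w = μ • w) → Module.finrank ℂ W ≤ 1)
    (U V : Submodule ℂ (Fin r × Fin n → ℂ))
    (hU : r * n ≤ Module.finrank ℂ U + d) (hV : r * n ≤ Module.finrank ℂ V + d)
    (hE : ∀ u ∈ U, ∀ v ∈ V, ∀ a b : Fin r,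
      ∑ i, u (a, i) * v (b, i) = ∑ i, A₁ u (a, i) * A₂ v (b, i)) :
    r ≤ d + 1 := by
  by_contra hrd
  push Not at hrd
  -- (3) uniqueness: no nonzero z is killed by all rows of all A₁ u, u ∈ U
  have uniq : ∀ z : Fin n → ℂ, (∀ u ∈ U, ∀ a : Fin r, ∑ i, A₁ u (a, i) * z i = 0) → z = 0 := by
    intro z hz
    by_contra hz0
    have hle : U.map A₁ ≤ LinearMap.ker ((LinearMap.pi fun a : Fin r => ∑ i : Fin n, z i • (LinearMap.proj (a, i) : (Fin r × Fin n → ℂ) →ₗ[ℂ] ℂ))) := by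
      rintro w ⟨u, hu, rfl⟩
      rw [LinearMap.mem_ker]
      ext a
      rw [rowContr_apply, Pi.zero_apply]
      exact hz u hu a
    have h1 := Submodule.finrank_mono hle
    have h2 := finrank_ker_rowContr (r := r) hz0
    have h3 := finrank_le_finrank_map_add A₁ U
    omega
  -- (4a) existence: for every y there is y' with (A₁ u)_mat y' = u_mat y on U
  have exist : ∀ y : Fin n → ℂ, ∃ y' : Fin n → ℂ, ∀ u ∈ U, ∀ a : Fin r,
      ∑ i, A₁ u (a, i) * y' i = ∑ i, u (a, i) * y i := by
    intro y
    by_cases hy : y = 0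
    · refine ⟨0, fun u _ a => by simp [hy]⟩
    -- a nonzero x with x ⊗ y ∈ V
    have hW : 2 ≤ Module.finrank ℂ (V.comap ((LinearMap.pi fun q : Fin r × Fin n => y q.2 • (LinearMap.proj q.1 : (Fin r → ℂ) →ₗ[ℂ] ℂ)))) := by
      have h := finrank_comap_ge ((LinearMap.pi fun q : Fin r × Fin n => y q.2 • (LinearMap.proj q.1 : (Fin r → ℂ) →ₗ[ℂ] ℂ))) (tensRight_injective hy) V
      rw [Module.finrank_fintype_fun_eq_card, Fintype.card_fin, Module.finrank_fintype_fun_eq_card,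
        Fintype.card_prod, Fintype.card_fin, Fintype.card_fin] at h
      omega
    obtain ⟨x, hxW, hx0⟩ : ∃ x ∈ V.comap ((LinearMap.pi fun q : Fin r × Fin n => y q.2 • (LinearMap.proj q.1 : (Fin r → ℂ) →ₗ[ℂ] ℂ))), x ≠ 0 := by
      apply Submodule.exists_mem_ne_zero_of_ne_bot
      intro hbot; rw [hbot, finrank_bot] at hW; omega
    obtain ⟨b₀, hb₀⟩ : ∃ b, x b ≠ 0 := by
      by_contra h; push Not at h; exact hx0 (funext h)
    have hxy : (LinearMap.pi fun q : Fin r × Fin n => y q.2 • (LinearMap.proj q.1 : (Fin r → ℂ) →ₗ[ℂ] ℂ)) x ∈ V := hxW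
    refine ⟨fun i => A₂ ((LinearMap.pi fun q : Fin r × Fin n => y q.2 • (LinearMap.proj q.1 : (Fin r → ℂ) →ₗ[ℂ] ℂ)) x) (b₀, i) * (x b₀)⁻¹, fun u hu a => ?_⟩
    have key := hE u hu ((LinearMap.pi fun q : Fin r × Fin n => y q.2 • (LinearMap.proj q.1 : (Fin r → ℂ) →ₗ[ℂ] ℂ)) x) hxy a b₀
    simp only [tensRight_apply] at key
    -- key : ∑ i, u (a,i) * (x b₀ * y i) = ∑ i, A₁ u (a,i) * A₂ ((LinearMap.pi fun q : Fin r × Fin n => y q.2 • (LinearMap.proj q.1 : (Fin r → ℂ) →ₗ[ℂ] ℂ)) x) (b₀, i)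
    have : ∑ i, A₁ u (a, i) * (A₂ ((LinearMap.pi fun q : Fin r × Fin n => y q.2 • (LinearMap.proj q.1 : (Fin r → ℂ) →ₗ[ℂ] ℂ)) x) (b₀, i) * (x b₀)⁻¹)
        = (∑ i, A₁ u (a, i) * A₂ ((LinearMap.pi fun q : Fin r × Fin n => y q.2 • (LinearMap.proj q.1 : (Fin r → ℂ) →ₗ[ℂ] ℂ)) x) (b₀, i)) * (x b₀)⁻¹ := by
      rw [Finset.sum_mul]; refine Finset.sum_congr rfl fun i _ => by ring
    rw [this, ← key, Finset.sum_mul]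
    refine Finset.sum_congr rfl fun i _ => ?_
    field_simp
  -- (4b) the transport map B as a function with the defining property, linear by uniqueness
  choose Bf hBf using exist
  have Badd : ∀ y y', Bf (y + y') = Bf y + Bf y' := by
    intro y y'
    have h := uniq (Bf (y + y') - (Bf y + Bf y')) (fun u hu a => ?_)
    · exact sub_eq_zero.mp h
    have e1 := hBf (y + y') u hu a
    have e2 := hBf y u hu a
    have e3 := hBf y' u hu a
    simp only [Pi.sub_apply, Pi.add_apply, mul_sub, mul_add, Finset.sum_sub_distrib,
      Finset.sum_add_distrib] at e1 ⊢
    rw [e1, e2, e3]; ring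
  have Bsmul : ∀ (c : ℂ) y, Bf (c • y) = c • Bf y := by
    intro c y
    have h := uniq (Bf (c • y) - c • Bf y) (fun u hu a => ?_)
    · exact sub_eq_zero.mp h
    have e1 := hBf (c • y) u hu a
    have e2 := hBf y u hu a
    simp only [Pi.sub_apply, Pi.smul_apply, smul_eq_mul, mul_sub, Finset.sum_sub_distrib] at e1 ⊢
    rw [e1]
    have : ∑ i, A₁ u (a, i) * (c * Bf y i) = c * ∑ i, A₁ u (a, i) * Bf y i := by
      rw [Finset.mul_sum]; refine Finset.sum_congr rfl fun i _ => by ring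
    rw [this, e2, Finset.mul_sum]
    have : ∑ i, u (a, i) * (c * y i) = ∑ i, c * (u (a, i) * y i) :=
      Finset.sum_congr rfl fun i _ => by ring
    rw [this]; ring
  let B : (Fin n → ℂ) →ₗ[ℂ] (Fin n → ℂ) :=
    { toFun := Bf, map_add' := Badd, map_smul' := Bsmul }
  -- (F) A₂ (x ⊗ y) = x ⊗ B y whenever x ⊗ y ∈ V
  have transport : ∀ (y : Fin n → ℂ) (x : Fin r → ℂ), (LinearMap.pi fun q : Fin r × Fin n => y q.2 • (LinearMap.proj q.1 : (Fin r → ℂ) →ₗ[ℂ] ℂ)) x ∈ V →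
      A₂ ((LinearMap.pi fun q : Fin r × Fin n => y q.2 • (LinearMap.proj q.1 : (Fin r → ℂ) →ₗ[ℂ] ℂ)) x) = (LinearMap.pi fun q : Fin r × Fin n => (Bf y) q.2 • (LinearMap.proj q.1 : (Fin r → ℂ) →ₗ[ℂ] ℂ)) x := by
    intro y x hxy
    ext ⟨b, j⟩
    -- the row-b defect vector is killed by all rows of A₁ u
    have hz := uniq (fun i => A₂ ((LinearMap.pi fun q : Fin r × Fin n => y q.2 • (LinearMap.proj q.1 : (Fin r → ℂ) →ₗ[ℂ] ℂ)) x) (b, i) - x b * Bf y i) (fun u hu a => ?_)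
    · have := congrFun hz j
      simp only [Pi.zero_apply, sub_eq_zero] at this
      rw [tensRight_apply]
      exact this
    have key := hE u hu ((LinearMap.pi fun q : Fin r × Fin n => y q.2 • (LinearMap.proj q.1 : (Fin r → ℂ) →ₗ[ℂ] ℂ)) x) hxy a b
    have hB := hBf y u hu a
    simp only [tensRight_apply] at key
    simp only [mul_sub, Finset.sum_sub_distrib]
    rw [← key]
    have : ∑ i, A₁ u (a, i) * (x b * Bf y i) = x b * ∑ i, A₁ u (a, i) * Bf y i := by
      rw [Finset.mul_sum]; refine Finset.sum_congr rfl fun i _ => by ring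
    rw [this, hB, Finset.mul_sum, ← Finset.sum_sub_distrib]
    refine Finset.sum_eq_zero fun i _ => by ring
  -- (5) an eigenvector y₀ of B gives a ≥ 2-dimensional eigenspace of A₂
  haveI : Nonempty (Fin n) := ⟨⟨0, hn⟩⟩
  obtain ⟨μ, hμ⟩ := Module.End.exists_eigenvalue B
  obtain ⟨y₀, hy₀⟩ := hμ.exists_hasEigenvector
  have hy₀ne : y₀ ≠ 0 := hy₀.2
  have hBy₀ : B y₀ = μ • y₀ := Module.End.mem_eigenspace_iff.mp hy₀.1
  have hBf₀ : Bf y₀ = μ • y₀ := hBy₀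
  set W := (V.comap ((LinearMap.pi fun q : Fin r × Fin n => y₀ q.2 • (LinearMap.proj q.1 : (Fin r → ℂ) →ₗ[ℂ] ℂ)))).map ((LinearMap.pi fun q : Fin r × Fin n => y₀ q.2 • (LinearMap.proj q.1 : (Fin r → ℂ) →ₗ[ℂ] ℂ))) with hWdef
  have hWeig : ∀ w ∈ W, A₂ w = μ • w := by
    rintro w ⟨x, hx, rfl⟩
    rw [transport y₀ x hx, hBf₀]
    ext p
    simp only [LinearMap.pi_apply, LinearMap.smul_apply, LinearMap.proj_apply, Pi.smul_apply, smul_eq_mul]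
    ring
  have hW1 := hA₂ μ W hWeig
  have hW2 : 2 ≤ Module.finrank ℂ W := by
    rw [hWdef, LinearEquiv.finrank_eq (Submodule.equivMapOfInjective _ (tensRight_injective hy₀ne) _).symm]
    have h := finrank_comap_ge ((LinearMap.pi fun q : Fin r × Fin n => y₀ q.2 • (LinearMap.proj q.1 : (Fin r → ℂ) →ₗ[ℂ] ℂ))) (tensRight_injective hy₀ne) V
    rw [Module.finrank_fintype_fun_eq_card, Fintype.card_fin, Module.finrank_fintype_fun_eq_card,
      Fintype.card_prod, Fintype.card_fin, Fintype.card_fin] at h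
    omega
  omega

end Summit.MatrixMultiplication.MatrixMultiplication.Theorems.KroneckerNeutral
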